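import Mathlib
import HarnessLib

/-!
# Crux `NNLinearDegreeCofactorHard` (stmt-ValiantsHypothesis-23918), line `internal_cofactor`, stub S2b (ii):
# PAIR CODES — the excluded letter pair of a boundary test as a forbidden set of bit codes (unit (C″-d))

SPEC `Cruxes/NNLinearDegreeCofactorHard/Lines/internal_cofactor-S2b-SPEC.md` S2/S8: the non-defect letters of the
inflated queue word come in PAIRS, pair `j` decoded from two uniform bits by the NEUTRAL decoder
(`00 ↦ DD, 01 ↦ DU, 10 ↦ UD, 11 ↦ UU`) or the INFLATION decoder (`00 ↦ UU, 01 ↦ UD, 10 ↦ DU, 11 ↦ UU`); a boundary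
test (`BoundaryTests.boundary_test_across`, `…boundary_test_across_pops`) excludes ONE letter pair among
`(U,U), (U,D), (D,U)` at two consecutive middle V-positions, which either STRADDLE two pairs (2nd letter of pair `j`,
1st letter of pair `j+1`: a 4-bit block) or lie INSIDE one pair (a 2-bit block).  This file records, by `decide`,
the sizes of the corresponding forbidden code sets — the `f` of `BlockTests.card_filter_blockAvoid_le` (p592179):

* `two_le_card_straddleCodes` — straddling: at least `2` of the `16` codes realise the excluded letter pair, for
  every combination of the two decoders (price `≤ 14/16 = 7/8` per test);
* `one_le_card_insideCodes` — inside a pair: at least `1` of the `4` codes (price `≤ 3/4`);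
* `decode_*` — the two decoders' tables as rewriting lemmas.

To stay definition-free this file spells the decoder out as the lambda
`fun κ b₀ b₁ => if κ then (!(b₀ && !b₁), !(!b₀ && b₁)) else (b₀, b₁)`; `decodePair` of unit (A″)
(`…InflateWordDefs.lean`) is the same term, so the bridge is `rfl`.

Honest framing: finite bookkeeping for ONE unit of an OPEN stub's measure construction; nothing here bears on S2b,
the crux or VP ≠ VNP.  No definitions, no named facts.
-/

-- Sub = Summit single-conjunct layout: the duplicated namespace component is mandated by the tree.
set_option linter.dupNamespace false

namespace Summit.ValiantsHypothesis.ValiantsHypothesis.Theorems.FifoMatching.NNLinearDegreeCofactorHard.PairCodes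

open Finset

/-- **Straddling codes.**  For decoder kinds `τ₁, τ₂` (`true` = inflation) and an excluded letter pair
`(ℓ₁, ℓ₂) ≠ (D, D)` read as (2nd letter of the first pair, 1st letter of the second pair), at least `2` of the `16`
four-bit codes realise it. [folklore] -/
theorem two_le_card_straddleCodes :
    ∀ τ₁ τ₂ ℓ₁ ℓ₂ : Bool, (ℓ₁, ℓ₂) ≠ (false, false) →
      2 ≤ (univ.filter fun c : Fin 4 → Bool =>
        ((fun (κ b₀ b₁ : Bool) => if κ then (!(b₀ && !b₁), !(!b₀ && b₁)) else (b₀, b₁)) τ₁ (c 0) (c 1)).2 = ℓ₁ ∧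
        ((fun (κ b₀ b₁ : Bool) => if κ then (!(b₀ && !b₁), !(!b₀ && b₁)) else (b₀, b₁)) τ₂ (c 2) (c 3)).1 = ℓ₂).card := by
  decide

/-- **Inside codes.**  For a decoder kind `τ` and an excluded letter pair `(ℓ₁, ℓ₂) ≠ (D, D)` of ONE pair, at least
`1` of the `4` two-bit codes realises it. [folklore] -/
theorem one_le_card_insideCodes :
    ∀ τ ℓ₁ ℓ₂ : Bool, (ℓ₁, ℓ₂) ≠ (false, false) →
      1 ≤ (univ.filter fun c : Fin 2 → Bool =>
        (fun (κ b₀ b₁ : Bool) => if κ then (!(b₀ && !b₁), !(!b₀ && b₁)) else (b₀, b₁)) τ (c 0) (c 1) = (ℓ₁, ℓ₂)).card := by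
  decide

/-- The NEUTRAL decoder is the identity on the two bits (`00 ↦ DD, 01 ↦ DU, 10 ↦ UD, 11 ↦ UU`). [folklore] -/
theorem decode_neutral (b₀ b₁ : Bool) :
    (fun (κ b₀ b₁ : Bool) => if κ then (!(b₀ && !b₁), !(!b₀ && b₁)) else (b₀, b₁)) false b₀ b₁ = (b₀, b₁) := rfl

/-- The INFLATION decoder's table: `00 ↦ UU, 01 ↦ UD, 10 ↦ DU, 11 ↦ UU`. [folklore] -/
theorem decode_inflate :
    (fun (κ b₀ b₁ : Bool) => if κ then (!(b₀ && !b₁), !(!b₀ && b₁)) else (b₀, b₁)) true false false = (true, true) ∧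
    (fun (κ b₀ b₁ : Bool) => if κ then (!(b₀ && !b₁), !(!b₀ && b₁)) else (b₀, b₁)) true false true = (true, false) ∧
    (fun (κ b₀ b₁ : Bool) => if κ then (!(b₀ && !b₁), !(!b₀ && b₁)) else (b₀, b₁)) true true false = (false, true) ∧
    (fun (κ b₀ b₁ : Bool) => if κ then (!(b₀ && !b₁), !(!b₀ && b₁)) else (b₀, b₁)) true true true = (true, true) := by
  decide

/-- Under the INFLATION decoder a pair never decodes to `(D, D)`: it pushes at least once (net `+1` on average:
`UU` with probability `1/2`, `UD`, `DU` with probability `1/4` each). [folklore] -/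
theorem decode_inflate_ne_DD (b₀ b₁ : Bool) :
    (fun (κ b₀ b₁ : Bool) => if κ then (!(b₀ && !b₁), !(!b₀ && b₁)) else (b₀, b₁)) true b₀ b₁ ≠ (false, false) := by
  revert b₀ b₁; decide

end Summit.ValiantsHypothesis.ValiantsHypothesis.Theorems.FifoMatching.NNLinearDegreeCofactorHard.PairCodes
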